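import Summits.AtomisticToContinuum.Crystallization.Theorems.ChartedZeroExcessLayeredLatticeLiouvilleUM

/-!
# Zero-excess layered lattice Liouville — part UN (lens-2 g54, node «CaccioppoliUnderClause»): the Caccioppoli leaf of line `_16XH19B(_tol)` UNDER THE
# BOND-ISOMORPHISM CLAUSE, MEASURED BY `Ψ` ITSELF — the currency `IsCoherentBy`; the Ψ-measured leaves [W_Ψᵇ] `CoherentWindowPsiBPG` / [CC°_Ψᵇ]
# `CoherentGscCaccioppoliPsiBPG` with the docket RE-FED through them (PROVED); the transfer [GΨᵇ] `CoherenceTransferBP` with `IsStarRigid` as the Lean `osc_H`;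
# the TYPED reduction [CC°_Ψᵇ] ⟸ glue((I0) `EquilChartIsometryP`, (I1) `PairForceTaylorP`, (I4) `TailFluxBP`, (I5) `CaccioppoliIterationP`, hU, hN, [KS], [SBᵇ])
# with ONE isolated undecided leaf [SBᵇ] `SubWindowBudgetBPG` («the registration budget does not concentrate on sub-windows»); modus ponens proved.

Continuation of part UM (critic row 858 (a)–(e)).  FINDINGS.
(s1) [W] `CoherentWindowPG` delivers g-COHERENCE `IsCoherentOn ϑ₁ ω₁ S H (win 9R)` — per star SOME map `g` into the chart lattice and SOME rotation (part UD),
  registration-free.  The Gårding mechanism behind [CC°_W] eats Ψ-COHERENCE: pointwise smallness of the discrete gradient of THE displacement `p − Ψ p` whose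
  strain the conclusion measures (`Ψ' := Ψ` under `IsBondIso`).  `IsCoherentBy ϑ₁ ω₁ S Ψ K` (§UN.1) is that currency; `IsCoherentBy ⇒ IsCoherentOn` is PROVED.
(s2) The converse is NOT loss-free: on a star whose `8`-environment in the chart lattice has a second, `1/4`-close but distinct realisation (aperiodic
  equilibrium charts: FREE stacking data `w`) `g` may register to the wrong copy, while the bond-isomorphic `Ψ` is pinned only up to the environment
  oscillation of `H` — in Lean `IsStarRigid ρ ϑ₂ H` (§UN.3); the transfer [GΨᵇ] is typed with the explicit loss `ϑ₁ ↦ ϑ₁ + ϑ₂`.  DECISION (D1) RE-FEED through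
  [W_Ψᵇ] ∧ [CC°_Ψᵇ] (`strainNonConcentrationBPG_1_50_of_docketPsi`, PROVED; ([W_Ψᵇ], [CC°_Wᵇ]) feeds it too via the PROVED seam `[CC°_Wᵇ] ⇒ [CC°_Ψᵇ]`).  (D2)
  «[W] ∧ [GΨᵇ] ⇒ [W_Ψᵇ]» is NOT a seam of record (the loss `osc_H` must fit the basin for every chart: a new leaf), banked behind [W]'s embargoed split (row
  772 (c)); (α) «prove [PGᵇ_(3/10)] now» stays OFF-DOCKET (rows 846/858: no seam consumes it).
(F3) THE TAIL AT SMALL BALLS (load-bearing for (d)).  [CC°] is asked on EVERY ball `B(x, r)`, `r ≥ r₀`, with data ball `B_{3r/2}`, while `pairForce`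
  decays like `‖z‖⁻⁷`: testing force balance on `B_t` against `ζ²W` leaves the work of the TAIL FORCE of sources outside `B_{3r/2}` — `O((ϑ₁ + ω₁)r⁻⁴)` per
  site from pointwise coherence (an η-INDEPENDENT floor) or `O(η(R/r)³r⁻²)` from the WHOLE-WINDOW levels of `IsGlobalReg` (fine only for `r ≥ R^{3/5}`); the
  chain is η-HOMOGENEOUS ((M♭ᵇ): strained mass `≤ ε·η·nK` for every `ε`) and [Cᵇ] (part UJ) has `∃ b` before `∀ η` over ALL balls, so neither an η-independent
  floor nor an η-dependent radius floor is admissible.  A SUB-WINDOW BUDGET `bondEnergy_{B(x,ρ)}(p ↦ p − Ψ p) ≤ A_B·η·nK(B(x,ρ))` (`ρ ≥ ρ₀`, inside `win 8R`)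
  closes it at every ball (tail work `≤ C√(A_B η nK(B_τ))/(τ − t)·√(bondEnergy φ)`, absorbed into `A·η` by the iteration).  Hence (d): [CC°_Ψᵇ] ⟸ GLUE((I0),
  (I1), (I4), (I5), hU, hN, [KS], [SBᵇ]) — (I2) is the tree identity `tailForce_layeredHom_eq_near_sub_near` (part TF) used INSIDE the glue — and the undecided
  content of [CC°_Wᵇ] is ISOLATED in [SBᵇ]: Morrey-type SPATIAL non-concentration of the budget ((M♭ᵇ) is AMPLITUDE non-concentration; neither implies the
  other in the tree), GSC-priced, INSTRUMENTABLE ((F4) «BudgetDensityScan»: max over sub-balls of `⨍_{B(x,ρ)} τ² / ⨍_{win} τ²` on the relaxed windows of TAG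
  174 (a⁗); kill sign: unbounded along `η̂ → 0`).  FLAG: [SBᵇ] is ε-regularity WITH LINEAR RATE for the distortion-energy density — possibly as strong as
  interior regularity of the strain; but it is ONE typed statement, not a mechanism paragraph.
CONTENTS §UN.1 `IsCoherentBy`; §UN.2 [W_Ψᵇ], [CC°_Ψᵇ], seams, re-fed docket (PROVED); §UN.3 `IsStarRigid`, [GΨᵇ]; §UN.4 (I1), (I0), (I5), (I4), [SBᵇ], glue,
modus ponens (PROVED), (e) UM's seed with `Cg·η` for `Cg·(R/R)·η`.  RESIDUALS of the line after this part: [T_bᵇ]; [W_Ψᵇ] (split embargoed with [W]); in place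
of [CC°_Wᵇ]: the glue (ATTACKABLE·M–L), [SBᵇ] (UNDECIDED · INSTRUMENTABLE), (I0) S, (I1) S, (I4) M, (I5) S (TRUE-type).  No `sorry`, no new axiom, no instance /
notation / option.  Literature: Giaquinta (1983) Ch. V Lemma 3.1, Ch. III §§1–2; Di Castro–Kuusi–Palatucci, Ann. IHP (C) 33 (2016) 1279; Kuusi–Mingione–Sire, Anal.
PDE 8 (2015) 57; Guadie–Malinnikova, arXiv 1306.1418; Ehrlacher–Ortner–Shapeev, ARMA 222 (2016) 1217; parts TB, TF, TP, UC, UD, UJ–UM.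
-/

noncomputable section

open scoped BigOperators InnerProductSpace RealInnerProductSpace
open MeasureTheory Set Metric Filter Topology
open Summit.AtomisticToContinuum.Crystallization.Theorems.ChartedPlanarOrderRigidityDoor (E3 atomsIn)
open Summit.AtomisticToContinuum.Crystallization.Theorems.ChartedPlanarOrderDensityDichotomy (μS IsSep nK nK_nonneg)
open Summit.AtomisticToContinuum.Crystallization.Theorems.ChartedPlanarOrderCleanScaleP (IsCleanP IsDoorSetP)
open Summit.AtomisticToContinuum.Crystallization.Theorems.ChartedPlanarOrderMesoCut (LayeredHom EnvClose)
open Summit.AtomisticToContinuum.Crystallization.Theorems.ChartedPlanarOrderDoorLayered (atomsIn_subset)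
open Summit.AtomisticToContinuum.Crystallization.Theorems.ChartedPlanarOrderDoorLayeredOsc (IsTwoShellAffineGood)
open Summit.AtomisticToContinuum.Crystallization.Theorems.ChartedPlanarOrderProfileSlavingLJ (pairForce)
open Literature.Analysis.PDE (finavg ZatorskaGoldstein2005_localGehringLemmaCounting)

namespace Summit.AtomisticToContinuum.Crystallization.Theorems.ChartedZeroExcessLayeredLatticeLiouville

/-! ### UN.1  Ψ-coherence: the currency the Caccioppoli mechanism eats -/

/-- ★ **`IsCoherentBy ϑ₁ ω₁ S Ψ K` — every `4`-star of `S` centred in `K` is `(ϑ₁, ω₁)`-coherent AS MEASURED BY `Ψ`**: a rotation `U` (`det = 1`, `tilt U ≤ ω₁`)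
moves every star bond `p − x` within `ϑ₁` of the IMAGE bond `Ψ p − Ψ x`.  Part UD's `IsCoherentOn` with the free per-star map `g` replaced by the given `Ψ`
(pointwise: tilt–strain data of `Ψ` with `σ ≤ ϑ₁`, `tilt Q ≤ ω₁` on `K`). [this file, g54] -/
def IsCoherentBy (ϑ₁ ω₁ : ℝ) (S : Set E3) (Ψ : E3 → E3) (K : Set E3) : Prop :=
  ∀ x ∈ K, ∃ U : E3 ≃ₗᵢ[ℝ] E3, LinearMap.det (U.toLinearEquiv : E3 →ₗ[ℝ] E3) = 1 ∧ tilt U ≤ ω₁ ∧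
    ∀ p ∈ S, dist p x ≤ 4 → dist (U (p - x)) (Ψ p - Ψ x) ≤ ϑ₁

/-- monotone in both thresholds, antitone in the set. [this file, g54] -/
theorem IsCoherentBy.mono {ϑ₁ ϑ₁' ω₁ ω₁' : ℝ} (hϑ : ϑ₁ ≤ ϑ₁') (hω : ω₁ ≤ ω₁') {S K K' : Set E3} {Ψ : E3 → E3} (hK : K' ⊆ K)
    (h : IsCoherentBy ϑ₁ ω₁ S Ψ K) : IsCoherentBy ϑ₁' ω₁' S Ψ K' := fun x hx => by
  obtain ⟨U, hU, ht, hb⟩ := h x (hK hx)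
  exact ⟨U, hU, ht.trans hω, fun p hp hpx => (hb p hp hpx).trans hϑ⟩

/-- **(s1, PROVED) Ψ-coherent ⇒ g-coherent** (`g := Ψ`): what [W_Ψᵇ] delivers contains what [W] delivers. [this file, g54] -/
theorem IsCoherentBy.isCoherentOn {ϑ₁ ω₁ : ℝ} {S H K : Set E3} {Ψ : E3 → E3} (h : IsCoherentBy ϑ₁ ω₁ S Ψ K) (hΨ : MapsTo Ψ S H) :
    IsCoherentOn ϑ₁ ω₁ S H K := fun x hx => by
  obtain ⟨U, hU, ht, hb⟩ := h x hx
  exact ⟨U, Ψ, hU, ht, fun _ hp => hΨ hp.1, hb⟩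

/-- DICTIONARY: tilt–strain data of `Ψ` with `σ ≤ ϑ₁`, `tilt Q ≤ ω₁` on `K ⊆ win R` witness Ψ-coherence on `K`. [this file, g54] -/
theorem isCoherentBy_of_tiltStrainData {S K : Set E3} {R : ℝ} {Ψ : E3 → E3} {Q : E3 → (E3 ≃ₗᵢ[ℝ] E3)} {σ : E3 → ℝ}
    (hd : IsTiltStrainData S R Ψ Q σ) (hK : K ⊆ atomsIn (μS S) 0 R) {ϑ₁ ω₁ : ℝ} (hσ : ∀ x ∈ K, σ x ≤ ϑ₁) (hQ : ∀ x ∈ K, tilt (Q x) ≤ ω₁) :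
    IsCoherentBy ϑ₁ ω₁ S Ψ K := fun x hx =>
  ⟨Q x, hd.1 x, hQ x hx, fun p hp hpx => (hd.2.2 x (hK hx) p hp hpx).trans (hσ x hx)⟩

/-- VACUITY GUARD: under a tear-free `Ψ` (`4 ↦ 8`) every star is `(12, 0)`-coherent by `Ψ` — the content is in SMALL `(ϑ₁, ω₁)`. [this file, g54] -/
theorem isCoherentBy_twelve_zero {S K : Set E3} {Ψ : E3 → E3} (htear : ∀ x ∈ S, ∀ p ∈ S, dist p x ≤ 4 → dist (Ψ p) (Ψ x) ≤ 8) (hK : K ⊆ S) :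
    IsCoherentBy 12 0 S Ψ K := fun _ hx =>
  ⟨LinearIsometryEquiv.refl ℝ E3, det_refl_E3_eq_one, tilt_refl.le, fun _ hp hpx => dist_rot_bond_le_twelve htear _ (hK hx) hp hpx⟩

/-! ### UN.2  The Ψ-measured leaves [W_Ψᵇ], [CC°_Ψᵇ]; seams; the docket re-fed (D1) -/

/-- ★★ **[W_Ψᵇ] «CoherentWindowPsiBPG ϑ aHi Λ θ s» — TAME FAT NEAR-FLAT GSC DOOR WINDOWS ARE Ψ-COHERENT AT EVERY TOLERANCE under the clause**: [W]'s binders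
with `IsBondIso S Ψ` added and the conclusion measured by `Ψ` (`IsCoherentBy`); it yields [W]'s conclusion under the clause (`IsCoherentBy.isCoherentOn`).  NEW ·
GSC-priced · UNDECIDED · INSTRUMENTABLE ((F1) «CoherenceScan» with the census registration itself) · split EMBARGOED with [W]'s (row 772 (c)).  Why it might fail: as
[W] (a tame warm self-equilibrated local state; a slowly wound tame region), plus (s2): a bond-isomorphic `Ψ` registered to the wrong one of two `1/4`-close
environments of an aperiodic chart — excluded only up to `osc_H` ([GΨᵇ]).  Sources: part UD ([W]); F. John 1961; Friesecke–James–Müller 2002 Thm 3.1. [this file, g54] -/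
def CoherentWindowPsiBPG (ϑ aHi Λ θ s : ℝ) : Prop :=
  ∀ ϑ₁ : ℝ, 0 < ϑ₁ → ∀ ω₁ : ℝ, 0 < ω₁ →
  ∀ δ : ℝ, 0 < δ → ∀ a : ℝ, 0 < a → ∀ Cg : ℝ, 1 ≤ Cg → ∀ K₀ : ℝ, 0 < K₀ → ∃ η₁ : ℝ, 0 < η₁ ∧ ∃ R₁ : ℝ, 0 < R₁ ∧
    ∀ S : Set E3, IsDoorSetPG aHi δ S → (∀ q ∈ S, IsTwoShellAffineGood θ S q) →
      ∀ η : ℝ, 0 < η → η ≤ η₁ → ∀ R : ℝ, R₁ ≤ R →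
        ∀ (L : E3 ≃L[ℝ] E3) (w : ℤ → E3), IsEquilChart a s Λ L w →
          ∀ Ψ : E3 → E3, IsGlobalReg Cg η R S (LayeredHom (L : E3 →L[ℝ] E3) w) Ψ → IsBondIso S Ψ →
            K₀ ≤ η * nK (atomsIn (μS S) 0 R) →
              IsTameOn ϑ S (LayeredHom (L : E3 →L[ℝ] E3) w) (atomsIn (μS S) 0 (9 * R)) →
              IsCoherentBy ϑ₁ ω₁ S Ψ (atomsIn (μS S) 0 (9 * R))

/-- ★★ **[CC°_Ψᵇ] «CoherentGscCaccioppoliPsiBPG ϑ aHi Λ θ s» — [CC°] IN THE Ψ-MEASURED PERTURBATIVE BASIN**: [CC°_Wᵇ] `CoherentGscCaccioppoliBPG` (part UL)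
VERBATIM with the hypothesis `IsCoherentOn ϑ₁ ω₁ S H (win 9R)` replaced by `IsCoherentBy ϑ₁ ω₁ S Ψ (win 9R)`.  WEAKER than [CC°_Wᵇ] (PROVED); with [W_Ψᵇ] it gives
[CC°ᵇ] (PROVED).  MECHANISM-KNOWN-type · REDUCED in §UN.4 to the glue over typed true-type pieces and the one undecided leaf [SBᵇ].  Why it might fail: through [SBᵇ]
(F3: the tail work at balls `r ≪ R^{3/5}` needs sub-window budgets), else through the typing as [CC°_W] (a)–(c).  Sources: parts UL/UD; [giaquinta1984 Ch. III §1,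
Ch. V Lemma 3.1]; Di Castro–Kuusi–Palatucci 2016; Ehrlacher–Ortner–Shapeev 2016 §§2–3. [this file, g54] -/
def CoherentGscCaccioppoliPsiBPG (ϑ aHi Λ θ s : ℝ) : Prop :=
  ∀ δ : ℝ, 0 < δ → ∀ a : ℝ, 0 < a → ∀ Cg : ℝ, 1 ≤ Cg → ∃ Cg' : ℝ, Cg ≤ Cg' ∧
    ∃ c₁ : ℝ, 0 < c₁ ∧ ∃ κ : ℝ, 0 < κ ∧ ∃ A : ℝ, 0 ≤ A ∧ ∃ r₀ : ℝ, 0 < r₀ ∧ ∃ ϑ₁ : ℝ, 0 < ϑ₁ ∧ ∃ ω₁ : ℝ, 0 < ω₁ ∧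
    ∀ K₀ : ℝ, 0 < K₀ → ∃ η₁ : ℝ, 0 < η₁ ∧ ∃ R₁ : ℝ, 0 < R₁ ∧
      ∀ S : Set E3, IsDoorSetPG aHi δ S → (∀ q ∈ S, IsTwoShellAffineGood θ S q) →
        ∀ η : ℝ, 0 < η → η ≤ η₁ → ∀ R : ℝ, R₁ ≤ R →
          ∀ (L : E3 ≃L[ℝ] E3) (w : ℤ → E3), IsEquilChart a s Λ L w →
            ∀ Ψ : E3 → E3, IsGlobalReg Cg η R S (LayeredHom (L : E3 →L[ℝ] E3) w) Ψ → IsBondIso S Ψ →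
              K₀ ≤ η * nK (atomsIn (μS S) 0 R) →
                IsTameOn ϑ S (LayeredHom (L : E3 →L[ℝ] E3) w) (atomsIn (μS S) 0 (9 * R)) →
                IsCoherentBy ϑ₁ ω₁ S Ψ (atomsIn (μS S) 0 (9 * R)) →
                ∃ Ψ' : E3 → E3, IsGlobalReg Cg' η R S (LayeredHom (L : E3 →L[ℝ] E3) w) Ψ' ∧
                  ∃ (Q : E3 → (E3 ≃ₗᵢ[ℝ] E3)) (σ : E3 → ℝ), IsTiltStrainData S (8 * R) Ψ' Q σ ∧ (∀ x, σ x ≤ 12) ∧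
                    (∑ᶠ x ∈ atomsIn (μS S) 0 (8 * R), σ x ^ 2) ≤ A * η * nK (atomsIn (μS S) 0 (8 * R)) ∧
                    ∀ x ∈ S, ∀ r : ℝ, 0 < r → r₀ ≤ r → S ∩ ball x (2 * r) ⊆ ball 0 (8 * R) →
                      ∀ (U : E3 ≃ₗᵢ[ℝ] E3) (v : E3), LinearMap.det (U.toLinearEquiv : E3 →ₗ[ℝ] E3) = 1 →
                        finavg (S ∩ ball x (3 / 2 * r)) (fun p => ‖Ψ' p - (U p + v)‖ ^ 2) ≤ κ * r ^ 2 →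
                          finavg (S ∩ ball x r) (fun y => σ y ^ 2) ≤
                            c₁ * (finavg (S ∩ ball x (3 / 2 * r)) (fun p => ‖Ψ' p - (U p + v)‖ ^ 2) / r ^ 2 + A * η)

/-- **SEAM (PROVED): `[CC°_Wᵇ] ⇒ [CC°_Ψᵇ]`** — Ψ-coherence is g-coherence with `g := Ψ` (`MapsTo` from `IsGlobalReg`'s `BijOn`). [this file, g54] -/
theorem coherentGscCaccioppoliPsiBPG_of_coherentGscCaccioppoliBPG {ϑ aHi Λ θ s : ℝ} (h : CoherentGscCaccioppoliBPG ϑ aHi Λ θ s) :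
    CoherentGscCaccioppoliPsiBPG ϑ aHi Λ θ s := by
  intro δ hδ a ha Cg hCg
  obtain ⟨Cg', hCg', c₁, hc₁, κ, hκ, A, hA, r₀, hr₀, ϑ₁, hϑ₁, ω₁, hω₁, hK⟩ := h δ hδ a ha Cg hCg
  refine ⟨Cg', hCg', c₁, hc₁, κ, hκ, A, hA, r₀, hr₀, ϑ₁, hϑ₁, ω₁, hω₁, fun K₀ hK₀ => ?_⟩
  obtain ⟨η₁, hη₁, R₁, hR₁, h1⟩ := hK K₀ hK₀
  exact ⟨η₁, hη₁, R₁, hR₁, fun S hS hgood η hη hηle R hR L w hLw Ψ hΨ hBI hfat htame hcoh =>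
    h1 S hS hgood η hη hηle R hR L w hLw Ψ hΨ hBI hfat htame (hcoh.isCoherentOn hΨ.1.mapsTo)⟩

/-- ★★★ **SEAM (PROVED): `[W_Ψᵇ] ∧ [CC°_Ψᵇ] ⇒ [CC°ᵇ]`** — the Ψ-measured dichotomy is exhaustive below the hot threshold under the clause: [W_Ψᵇ] at the
basin [CC°_Ψᵇ] chose, thresholds `min / max`; NO constant matched across the seam. [this file, g54] -/
theorem tameGscCaccioppoliFloorBPG_of_coherentPsi {ϑ aHi Λ θ s : ℝ} (hW : CoherentWindowPsiBPG ϑ aHi Λ θ s)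
    (hC : CoherentGscCaccioppoliPsiBPG ϑ aHi Λ θ s) : TameGscCaccioppoliFloorBPG ϑ aHi Λ θ s := by
  intro δ hδ a ha Cg hCg
  obtain ⟨Cg', hCg', c₁, hc₁, κ, hκ, A, hA, r₀, hr₀, ϑ₁, hϑ₁, ω₁, hω₁, hK⟩ := hC δ hδ a ha Cg hCg
  refine ⟨Cg', hCg', c₁, hc₁, κ, hκ, A, hA, r₀, hr₀, fun K₀ hK₀ => ?_⟩
  obtain ⟨η₁, hη₁, R₁, hR₁, h1⟩ := hW ϑ₁ hϑ₁ ω₁ hω₁ δ hδ a ha Cg hCg K₀ hK₀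
  obtain ⟨η₁', hη₁', R₁', hR₁', h2⟩ := hK K₀ hK₀
  refine ⟨min η₁ η₁', lt_min hη₁ hη₁', max R₁ R₁', lt_max_of_lt_left hR₁, ?_⟩
  intro S hS hgood η hη hηle R hR L w hLw Ψ hΨ hBI hfat htame
  exact h2 S hS hgood η hη (hηle.trans (min_le_right _ _)) R ((le_max_right _ _).trans hR) L w hLw Ψ hΨ hBI hfat htame
    (h1 S hS hgood η hη (hηle.trans (min_le_left _ _)) R ((le_max_left _ _).trans hR) L w hLw Ψ hΨ hBI hfat htame)

/-- ★★★ **COROLLARY (PROVED): the Ψ-measured dressed-core line down to (Mᵇ)** — `[I_D] ∧ [T_bᵇ] ∧ [KS] ∧ [W_Ψᵇ] ∧ [CC°_Ψᵇ] ∧ leaf ⇒ StrainNonConcentrationBPG`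
(`aHi ≤ 8/7`). [this file, g54] -/
theorem strainNonConcentrationBPG_of_dressedCore_linePsi {ϑ ϑe ωe : ℝ} {p : ℕ} {r₀ ℓ : ℝ} {M : ℕ} {aHi Λ θ s : ℝ} (haHi : aHi ≤ 8 / 7)
    (hG : ZatorskaGoldstein2005_localGehringLemmaCounting) (hI : DressedCorePG ϑ ϑe ωe p r₀ ℓ M aHi Λ θ s)
    (hTb : BareTameWindowBPG ϑ ϑe ωe p r₀ ℓ M aHi Λ θ s) (hKS : KornSobolevPoincareP aHi θ) (hW : CoherentWindowPsiBPG ϑ aHi Λ θ s)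
    (hC : CoherentGscCaccioppoliPsiBPG ϑ aHi Λ θ s) : StrainNonConcentrationBPG aHi Λ θ s :=
  strainNonConcentrationBPG_of_rigidCaccioppoliBPG haHi hG
    (rigidCaccioppoliBPG_of_tame_line (tameWindowBPG_of_dressedCore_of_bare hI hTb) hKS (tameGscCaccioppoliFloorBPG_of_coherentPsi hW hC))

/-- ★★★ **THE DOCKET RE-FED (D1, PROVED)** — `(Mᵇ) StrainNonConcentrationBPG 1 2 (1/16) (1/50) ⟸ Gehring-leaf ∧ [I_D] ∧ [T_bᵇ] ∧ [KS] ∧ [W_Ψᵇ] ∧ [CC°_Ψᵇ]` at the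
literals of part UL's docket. [this file, g54] -/
theorem strainNonConcentrationBPG_1_50_of_docketPsi (hG : ZatorskaGoldstein2005_localGehringLemmaCounting)
    (hI : DressedCorePG tameRadius dressLevel dressLevel dressExponent 8 collarRadius clusterSize 1 2 (1 / 16) (1 / 50))
    (hTb : BareTameWindowBPG tameRadius dressLevel dressLevel dressExponent 8 collarRadius clusterSize 1 2 (1 / 16) (1 / 50))
    (hKS : KornSobolevPoincareP 1 (1 / 16)) (hW : CoherentWindowPsiBPG tameRadius 1 2 (1 / 16) (1 / 50))
    (hC : CoherentGscCaccioppoliPsiBPG tameRadius 1 2 (1 / 16) (1 / 50)) : StrainNonConcentrationBPG 1 2 (1 / 16) (1 / 50) :=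
  strainNonConcentrationBPG_of_dressedCore_linePsi (by norm_num) hG hI hTb hKS hW hC

/-! ### UN.3  (s2) `osc_H` in Lean and the coherence transfer [GΨᵇ] -/

/-- ★ **`IsStarRigid ρ ϑ₂ H` — environment rigidity of the model set (the Lean form of `osc_H`)**: two `ρ`-environments of `H` that match within `1/4` match
within `ϑ₂`.  A periodic lattice with finitely many environment classes is `(ρ, 0)`-rigid once `1/4` separates the classes; an equilibrium chart with FREE
stacking data `w` (part Q) is rigid only up to the oscillation of `w`. [this file, g54] -/
def IsStarRigid (ρ ϑ₂ : ℝ) (H : Set E3) : Prop :=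
  ∀ q ∈ H, ∀ q' ∈ H, EnvClose (1 / 4) ρ H q H q' → EnvClose ϑ₂ ρ H q H q'

/-- ★★ **[GΨᵇ] «CoherenceTransferBP ϑ aHi Λ θ s» — g-COHERENT ⇒ Ψ-COHERENT UP TO CHART SYMMETRY** (seam (s2) typed): on a tame near-flat window with a
bond-isomorphic global registration `Ψ` to an `(8, ϑ₂)`-rigid equilibrium chart, `(ϑ₁, ω₁)`-coherence by free star maps gives `(ϑ₁ + ϑ₂, ω₁)`-coherence BY `Ψ` (`g`
and `Ψ` register the `8`-environment of `x` to `1/4`-close environments of `H`; rigidity moves one onto the other within `ϑ₂`; the rotation is kept).  GEOMETRY ·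
PROVABLE·M (P-door: no GSC) · OFF-DOCKET ((D2): the loss `ϑ₂` must fit the basin).  Why it might fail: only if `IsBondIso` + tear-freeness do not pin `Ψ` on the
`8`-environment to a `1/4`-matching (a gratuitous relabelling inside the second shell).  Sources: parts TG (§X), UM (germ dichotomy), UD. [this file, g54] -/
def CoherenceTransferBP (ϑ aHi Λ θ s : ℝ) : Prop :=
  ∀ ϑ₁ : ℝ, 0 < ϑ₁ → ϑ₁ ≤ 1 / 10 → ∀ ω₁ : ℝ, 0 < ω₁ → ω₁ ≤ 1 / 10 → ∀ ϑ₂ : ℝ, 0 ≤ ϑ₂ →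
  ∀ δ : ℝ, 0 < δ → ∀ a : ℝ, 0 < a → ∀ Cg : ℝ, 1 ≤ Cg → ∃ η₁ : ℝ, 0 < η₁ ∧ ∃ R₁ : ℝ, 0 < R₁ ∧
    ∀ S : Set E3, IsDoorSetP aHi δ S → (∀ q ∈ S, IsTwoShellAffineGood θ S q) →
      ∀ η : ℝ, 0 < η → η ≤ η₁ → ∀ R : ℝ, R₁ ≤ R →
        ∀ (L : E3 ≃L[ℝ] E3) (w : ℤ → E3), IsEquilChart a s Λ L w → IsStarRigid 8 ϑ₂ (LayeredHom (L : E3 →L[ℝ] E3) w) →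
          ∀ Ψ : E3 → E3, IsGlobalReg Cg η R S (LayeredHom (L : E3 →L[ℝ] E3) w) Ψ → IsBondIso S Ψ →
            IsTameOn ϑ S (LayeredHom (L : E3 →L[ℝ] E3) w) (atomsIn (μS S) 0 (9 * R)) →
            IsCoherentOn ϑ₁ ω₁ S (LayeredHom (L : E3 →L[ℝ] E3) w) (atomsIn (μS S) 0 (9 * R)) →
              IsCoherentBy (ϑ₁ + ϑ₂) ω₁ S Ψ (atomsIn (μS S) 0 (9 * R))

/-! ### UN.4  (d) The reduction of [CC°_Ψᵇ]: true-type pieces, the isolated leaf [SBᵇ], the glue; (e) part UM's seed without the `R/R` -/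

/-- **(I1) `PairForceTaylorP` — UNIFORM SECOND-ORDER EXPANSION of the Lennard-Jones pair force off the core**: the Taylor remainder `pairForce (z + h) − pairForce z
+ forceConst z h` (`forceConst z = −D pairForce z`, part B) is `≤ C‖h‖²` for `‖z‖ ≥ 27/32`, `‖h‖ ≤ 1/4`.  TRUE-type · PROVABLE·S (`pairForce` is smooth off the
core; mean-value form of the remainder with `sup ‖D² pairForce‖` on `‖z‖ ≥ 19/32`). -/
def PairForceTaylorP : Prop :=
  ∃ C : ℝ, 0 < C ∧ ∀ z h : E3, 27 / 32 ≤ ‖z‖ → ‖h‖ ≤ 1 / 4 → ‖pairForce (z + h) - pairForce z + forceConst z h‖ ≤ C * ‖h‖ ^ 2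

/-- **(I0) `EquilChartIsometryP` — THE CHART CLASS IS INVARIANT UNDER RIGID MOTIONS** (`L' := U ∘ L`, `w' m := U (w m) + v`): lets the glue linearise about the
ROTATED chart `U⁻¹(H − v)` — an exact unstrained equilibrium — instead of carrying the affine defect `(1 − U)p − v` (whose symmetric part is an inner-elasticity
source for non-centrosymmetric charts).  TRUE-type · PROVABLE·S. -/
def EquilChartIsometryP : Prop :=
  ∀ (a s Λ : ℝ) (L : E3 ≃L[ℝ] E3) (w : ℤ → E3) (U : E3 ≃ₗᵢ[ℝ] E3) (v : E3), IsEquilChart a s Λ L w →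
    ∃ (L' : E3 ≃L[ℝ] E3) (w' : ℤ → E3), IsEquilChart a s Λ L' w' ∧
      LayeredHom (L' : E3 →L[ℝ] E3) w' = (fun q => U q + v) '' LayeredHom (L : E3 →L[ℝ] E3) w

/-- **(I5) `CaccioppoliIterationP` — THE ITERATION LEMMA** [giaquinta1984 Ch. V Lemma 3.1]: a nonnegative bounded `f` on `[r₀, r₁]` with `f t ≤ θ f τ + A/(τ − t)^k
+ B` for all `r₀ ≤ t < τ ≤ r₁` (`θ < 1`) satisfies `f r₀ ≤ c(θ, k)·(A/(r₁ − r₀)^k + B)`.  TRUE-type · PROVABLE·S (geometric sequence of radii). -/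
def CaccioppoliIterationP : Prop :=
  ∀ θ : ℝ, 0 ≤ θ → θ < 1 → ∀ k : ℕ, 0 < k → ∃ c : ℝ, 0 < c ∧
    ∀ (f : ℝ → ℝ) (A B r₀ r₁ : ℝ), 0 ≤ A → 0 ≤ B → r₀ < r₁ → (∀ t ∈ Icc r₀ r₁, 0 ≤ f t) → BddAbove (f '' Icc r₀ r₁) →
      (∀ t τ : ℝ, r₀ ≤ t → t < τ → τ ≤ r₁ → f t ≤ θ * f τ + A / (τ - t) ^ k + B) →
        f r₀ ≤ c * (A / (r₁ - r₀) ^ k + B)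

/-- ★ **(I4) `TailFluxBP aHi Λ θ s` — THE WORK OF THE TAIL FORCE ON A BALL** (F3; no GSC): for a bijective two-sided tear-free `Ψ : S → H` onto an equilibrium
chart lattice, `φ` supported in `S ∩ B(x, t)`, `τ > t ≥ 8ϱ`, GIVEN a bond-distortion level `Θ` on the balls `B(x, ρ)`, `ρ ≥ τ` (growth `ρ/τ` allowed), the work of
`tailForce ϱ` against `φ` is `≤ (εf·√(bondEnergy_{B_τ}(p ↦ p − Ψ p)) + AT·√(Θ·nK(B_τ))/max(τ − t, 1))·√(bondEnergy_{B_τ} φ)` — inside `B_τ` by path-Poincaré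
(`εf ~ ϱ⁻²`), outside by dyadic shells (`D⁻⁸` kernel; pairs through a bond `≲ D⁻³·bondEnergy_{B(x,t+2D)}` for `D ≤ t`, `t³D⁻⁶·(…)` beyond).  TRUE-type · ATTACKABLE·M.
Why it might fail: only through the counting on P-door sets (bond-connectivity with path length `≲` distance inside balls).  Sources: part TB ((FF));
Di Castro–Kuusi–Palatucci 2016 (tail term); Ehrlacher–Ortner–Shapeev 2016 (lattice Green bounds). [this file, g54] -/
def TailFluxBP (aHi Λ θ s : ℝ) : Prop :=
  ∀ δ : ℝ, 0 < δ → ∀ a : ℝ, 0 < a → ∀ εf : ℝ, 0 < εf → ∃ ϱ₀ : ℝ, 1 ≤ ϱ₀ ∧ ∀ ϱ : ℝ, ϱ₀ ≤ ϱ → ∃ AT : ℝ, 0 ≤ AT ∧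
    ∀ S : Set E3, IsDoorSetP aHi δ S → (∀ q ∈ S, IsTwoShellAffineGood θ S q) →
      ∀ (L : E3 ≃L[ℝ] E3) (w : ℤ → E3), IsEquilChart a s Λ L w →
        ∀ Ψ : E3 → E3, Set.BijOn Ψ S (LayeredHom (L : E3 →L[ℝ] E3) w) →
          (∀ x ∈ S, ∀ p ∈ S, dist p x ≤ 4 → dist (Ψ p) (Ψ x) ≤ 8) → (∀ x ∈ S, ∀ p ∈ S, dist (Ψ p) (Ψ x) ≤ 4 → dist p x ≤ 8) →
          ∀ x ∈ S, ∀ t τ Θ : ℝ, 8 * ϱ ≤ t → t < τ → 0 ≤ Θ →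
            (∀ ρ : ℝ, τ ≤ ρ → bondEnergy (S ∩ ball x ρ) (fun p => p - Ψ p) ≤ Θ * (ρ / τ) * nK (S ∩ ball x ρ)) →
            ∀ φ : E3 → E3, (∀ y : E3, y ∉ S ∩ ball x t → φ y = 0) →
              |∑ᶠ y ∈ S ∩ ball x t, ⟪tailForce ϱ S (LayeredHom (L : E3 →L[ℝ] E3) w) Ψ y, φ y⟫_ℝ| ≤
                (εf * Real.sqrt (bondEnergy (S ∩ ball x τ) (fun p => p - Ψ p)) +
                    AT * Real.sqrt (Θ * nK (S ∩ ball x τ)) / max (τ - t) 1) * Real.sqrt (bondEnergy (S ∩ ball x τ) φ)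

/-- ★★ **[SBᵇ] «SubWindowBudgetBPG ϑ aHi Λ θ s» — THE REGISTRATION BUDGET DOES NOT CONCENTRATE ON SUB-WINDOWS** (the isolated undecided leaf beneath [CC°_Ψᵇ]):
on a tame, Ψ-coherent (basin of the prover's choice), fat, near-flat GSC door window the bond-distortion energy of `Ψ` on EVERY ball `B(x, ρ) ⊆ win 8R`, `ρ ≥ ρ₀`, is
`≤ A_B·η·nK(S ∩ B(x, ρ))` — local density at most `A_B ×` the global level, at all scales.  Morrey-type SPATIAL non-concentration ((M♭ᵇ) is AMPLITUDE
non-concentration; neither implies the other in the tree).  NEW as a typed leaf · GSC-priced (e⋆-GSC sub-additivity alone gives density `C/ρ`, not `∝ η`) ·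
UNDECIDED · INSTRUMENTABLE ((F4) «BudgetDensityScan»).  Why it might fail: it is ε-regularity WITH LINEAR RATE for the distortion-energy density — a tame coherent
equilibrium piling a fixed fraction of the window's budget `η·R³` into a sub-window of size `o(R)` (slow rotation pile-up below every pointwise threshold) is
excluded by no tree theorem; possibly as strong as interior regularity of the strain.  Sources: [giaquinta1984 Ch. III §§1–2]; Ehrlacher–Ortner–Shapeev 2016;
Kuusi–Mingione–Sire 2015; parts TB (`IsGlobalReg`: whole-window levels only), UD, UL. [this file, g54] -/
def SubWindowBudgetBPG (ϑ aHi Λ θ s : ℝ) : Prop :=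
  ∀ δ : ℝ, 0 < δ → ∀ a : ℝ, 0 < a → ∀ Cg : ℝ, 1 ≤ Cg → ∃ AB : ℝ, 0 ≤ AB ∧ ∃ ρ₀ : ℝ, 0 < ρ₀ ∧ ∃ ϑ₁ : ℝ, 0 < ϑ₁ ∧ ∃ ω₁ : ℝ, 0 < ω₁ ∧
    ∀ K₀ : ℝ, 0 < K₀ → ∃ η₁ : ℝ, 0 < η₁ ∧ ∃ R₁ : ℝ, 0 < R₁ ∧
      ∀ S : Set E3, IsDoorSetPG aHi δ S → (∀ q ∈ S, IsTwoShellAffineGood θ S q) →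
        ∀ η : ℝ, 0 < η → η ≤ η₁ → ∀ R : ℝ, R₁ ≤ R →
          ∀ (L : E3 ≃L[ℝ] E3) (w : ℤ → E3), IsEquilChart a s Λ L w →
            ∀ Ψ : E3 → E3, IsGlobalReg Cg η R S (LayeredHom (L : E3 →L[ℝ] E3) w) Ψ → IsBondIso S Ψ →
              K₀ ≤ η * nK (atomsIn (μS S) 0 R) →
                IsTameOn ϑ S (LayeredHom (L : E3 →L[ℝ] E3) w) (atomsIn (μS S) 0 (9 * R)) →
                IsCoherentBy ϑ₁ ω₁ S Ψ (atomsIn (μS S) 0 (9 * R)) →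
                  ∀ x ∈ S, ∀ ρ : ℝ, ρ₀ ≤ ρ → S ∩ ball x ρ ⊆ ball 0 (8 * R) →
                    bondEnergy (S ∩ ball x ρ) (fun p => p - Ψ p) ≤ AB * η * nK (S ∩ ball x ρ)

/-- ★★ **THE GLUE `CaccioppoliGlueBPG ϑ aHi Λ θ s ν` — Gårding + cut-off + tail + iteration ⇒ [CC°_Ψᵇ]** (typed; every antecedent typed, none undecided but
[SBᵇ]).  The prover's bookkeeping (`Ψ' := Ψ`, `Q x :=` the κ-near `U`): (G1) by (I0) pass to the rotated chart `H̃ := U⁻¹(H − v)`, `Ψ̃ := U⁻¹(Ψ − v)`, `W̃ = −U⁻¹W`;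
(G2) force balance of `S` (Nash) minus that of `H̃` at `Ψ̃ y` (part TF `tailForce_layeredHom_eq_near_sub_near` = (I2): zeroth order cancels) tested against `ζ²W̃`;
(G3) near part: `forceConst` bilinear form `+` (I1)-remainder `≤ C(ϑ₁ + ω₁ + tilt U)·Σζ²|∇W̃|²`; (G4) Gårding from hU (`CoerciveZ` of the truncated form) and hN,
Korn on `ζW̃`; (G5) tail by (I4) with `Θ := 2A_B·η + C·tilt(U)²` ([SBᵇ] inside `win 16R`, `IsGlobalReg`'s levels outside) and `tilt(U)² ≤ C(⨍_{B_{3r/2}}|W|²/r² +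
A_B η)` by [KS] (the κ-near frame is the budget's frame or is visible in `W`); (G6) absorb (`θ := C(ϑ₁ + ω₁ + √κ + εf) < 1`: the prover's basin) and iterate by
(I5) on `[r, 3r/2]` (`k = 2`; collars `≥ 1`, bonds `≤ 4`); (G7) `σ_y ≤ |∇W̃|` star-wise, `Cg' := Cg`, `A := C·A_B + C`.  MECHANISM-KNOWN · ATTACKABLE·M–L.  Why it
might fail: (G5) needs [KS]'s ball constants uniform in `r ≥ r₀` (they depend on `δ` only).  Sources: [giaquinta1984 Ch. III §1, Ch. V §3]; Ehrlacher–Ortner–Shapeev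
2016 §§2–3; E–Ming 2007; parts B, TF, TP, UC. [this file, g54] -/
def CaccioppoliGlueBPG (ϑ aHi Λ θ s ν : ℝ) : Prop :=
  EquilChartIsometryP → PairForceTaylorP → TailFluxBP aHi Λ θ s → CaccioppoliIterationP →
    UniformTameStabilityE s Λ ν → EnergyNearChartPX aHi Λ θ s ν → KornSobolevPoincareP aHi θ → SubWindowBudgetBPG ϑ aHi Λ θ s →
      CoherentGscCaccioppoliPsiBPG ϑ aHi Λ θ s

/-- **[CC°_Ψᵇ] from the pieces (PROVED modus ponens)** — the shape of the reduction: glue ∧ (I0) ∧ (I1) ∧ (I4) ∧ (I5) ∧ hU ∧ hN ∧ [KS] ∧ [SBᵇ] ⇒ [CC°_Ψᵇ]. -/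
theorem coherentGscCaccioppoliPsiBPG_of_pieces {ϑ aHi Λ θ s ν : ℝ} (hglue : CaccioppoliGlueBPG ϑ aHi Λ θ s ν) (h0 : EquilChartIsometryP)
    (h1 : PairForceTaylorP) (h4 : TailFluxBP aHi Λ θ s) (h5 : CaccioppoliIterationP) (hU : UniformTameStabilityE s Λ ν)
    (hN : EnergyNearChartPX aHi Λ θ s ν) (hKS : KornSobolevPoincareP aHi θ) (hSB : SubWindowBudgetBPG ϑ aHi Λ θ s) :
    CoherentGscCaccioppoliPsiBPG ϑ aHi Λ θ s :=
  hglue h0 h1 h4 h5 hU hN hKS hSB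

/-- Record example: the docket through the pieces at column `_16XH19B`'s literals (`ν = 1/2000`; hU, hN are that column's certs): residuals [T_bᵇ], [W_Ψᵇ], [SBᵇ]. -/
example (hG : ZatorskaGoldstein2005_localGehringLemmaCounting)
    (hI : DressedCorePG tameRadius dressLevel dressLevel dressExponent 8 collarRadius clusterSize 1 2 (1 / 16) (1 / 50))
    (hTb : BareTameWindowBPG tameRadius dressLevel dressLevel dressExponent 8 collarRadius clusterSize 1 2 (1 / 16) (1 / 50))
    (hKS : KornSobolevPoincareP 1 (1 / 16)) (hW : CoherentWindowPsiBPG tameRadius 1 2 (1 / 16) (1 / 50))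
    (hglue : CaccioppoliGlueBPG tameRadius 1 2 (1 / 16) (1 / 50) (1 / 2000)) (h0 : EquilChartIsometryP) (h1 : PairForceTaylorP)
    (h4 : TailFluxBP 1 2 (1 / 16) (1 / 50)) (h5 : CaccioppoliIterationP) (hU : UniformTameStabilityE (1 / 50) 2 (1 / 2000))
    (hN : EnergyNearChartPX 1 2 (1 / 16) (1 / 50) (1 / 2000)) (hSB : SubWindowBudgetBPG tameRadius 1 2 (1 / 16) (1 / 50)) :
    StrainNonConcentrationBPG 1 2 (1 / 16) (1 / 50) :=
  strainNonConcentrationBPG_1_50_of_docketPsi hG hI hTb hKS hW (coherentGscCaccioppoliPsiBPG_of_pieces hglue h0 h1 h4 h5 hU hN hKS hSB)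

/-- the literal seed of part UM with `Cg·η` in place of `Cg·(R/R)·η` (`div_self`; part UM untouched). [this file, g54] -/
theorem exists_profile_lt_half_of_globalReg' {δ Cg η R : ℝ} (hδ : 0 < δ) (hR : 0 < R) {S H : Set E3} {Ψ : E3 → E3} (hsep : IsSep δ S)
    (h0 : (0 : E3) ∈ S) (hΨ : IsGlobalReg Cg η R S H Ψ) (hκ : Cg * η < 1 / 4) :
    ∃ τ : E3 → ℝ, IsRegistered (Cg * η) 4 R S (atomsIn (μS S) 0 R) H Ψ τ ∧ ∃ x ∈ atomsIn (μS S) 0 R, τ x < 1 / 2 := by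
  have h := exists_profile_lt_half_of_globalReg hδ hR hsep h0 hΨ hκ
  rwa [div_self hR.ne', mul_one] at h

end Summit.AtomisticToContinuum.Crystallization.Theorems.ChartedZeroExcessLayeredLatticeLiouville

end
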